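import Literature.IUT.HodgeTheaters.LocalFrobenioidsWitness
import HarnessLib

/-!
# [IUTchI] Example 3.2: the ten "may be reconstructed category-theoretically" clauses are
# jointly CONSISTENT with the interface `BadLocalFrobenioid` (kernel witness)

Mochizuki, *Inter-universal Teichmüller theory I*, §3, Example 3.2 (ii), (iii), (vi) (a)–(f) and
Remark 3.2.3 (i), kurims May-2020 manuscript pp. 69–75 [claim: Mochizuki2012, status: disputed].
abc-iut cell, WAVE-4 (D-0067) cone-interior seat abc-iut-w4-d047; DAG nodes `IUTchI:Ex3.2(i)`–`(vi)`.

`BadLocalFrobenioid.lean` (abc-iut-L5-t2) types the reconstruction sentences of Example 3.2 as ten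
MODEL-RELATIVE `Prop`s on the interface `BadLocalFrobenioid l K_v`:
`BiratFromF`, `CFromF`, `ThetaFromF` (Ex. 3.2 (ii), (iii)), `DdashFromD`, `DThetaFromD`, `BasesFromC`,
`DFromF`, `FthetaFromF`, `FdashFromC` (Ex. 3.2 (vi) (a)–(f)), `OrbitActsOnFtheta` (Rmk. 3.2.3 (i)).
They are properties the REAL construction (tempered Frobenioids of [EtTh] §5, `p_v`-adic Frobenioids of
[FrdII]) is claimed to have; they are not consequences of the interface fields (a companion file,
`BadLocalFrobenioidClaimsIndependence.lean`, is to give an inhabitant of the interface violating several of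
them: e.g. `DdashFromD = ReconstructibleAlong incl` fails for the reflective full embedding "doubling"
`WithTop ℤ ⥤ WithTop ℤ` under the shift self-equivalence).

THIS FILE proves that all ten hold on abc-iut-L5-t2's landed inhabitant `BadLocalFrobenioid.trivial l K_v`
(`LocalFrobenioidsWitness.lean`: every carrier the terminal category), for EVERY `l` and EVERY valued
field `K_v`, and records the conjunction `BadLocalFrobenioid.trivial_ex32Claims`. Consequence: a
statement downstream ([IUTchII]-side kits) that takes any subset of these ten clauses as hypotheses on a
`BadLocalFrobenioid` is NOT vacuously true. Nothing here asserts anything about the objects of the text;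
typed ≠ proved; no side is taken on [IUTchIII] Cor. 3.12.
-/

namespace Literature.IUT.HodgeTheaters

open CategoryTheory

namespace Witness

/-- Every "lift a self-equivalence compatibly along `Φ : T ⥤ Pt`" problem with TARGET the terminal
category is solved by the identity: any two functors into `Pt` are isomorphic. [folklore] -/
private theorem exists_equiv_comp_iso_of_pt {T : Type} [Category.{0} T] (Φ : T ⥤ Pt) (e : T ≌ T) :
    ∃ e' : Pt ≌ Pt, Nonempty (Φ ⋙ e'.functor ≅ e.functor ⋙ Φ) :=
  ⟨CategoryTheory.Equivalence.refl, ⟨isoOfPt _ _⟩⟩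

/-- `ReconstructibleAlong Φ` holds whenever the reconstructed category `T` is the terminal category:
lift by the identity. [folklore] -/
private theorem reconstructibleAlong_of_pt {S : Type} [Category.{0} S] (Φ : Pt ⥤ S)
    (hS : ∀ F G : Pt ⥤ S, Nonempty (F ≅ G)) : ReconstructibleAlong Φ :=
  fun _ => ⟨CategoryTheory.Equivalence.refl, hS _ _⟩

/-- Any two functors `Pt ⥤ Pt` are isomorphic. [folklore] -/
private theorem nonempty_iso_pt_pt (F G : Pt ⥤ Pt) : Nonempty (F ≅ G) := ⟨isoOfPt F G⟩

/-- The empty splitting `⊥` on `Pt` is preserved by every endofunctor of `Pt`. [folklore] -/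
private theorem botSplitting_pt_isPreservedBy (Φ : Pt ⥤ Pt) :
    (botSplitting Pt).IsPreservedBy (botSplitting Pt) Φ :=
  fun _ => Submonoid.map_bot _

end Witness

open Witness

namespace BadLocalFrobenioid

variable (l : ℕ) (Kv : Type) [Field Kv] [ValuativeRel Kv]

/-- Ex. 3.2 (ii) `BiratFromF` ("`F÷_v` may be reconstructed category-theoretically from `F̲_v`") holds
on the trivial inhabitant. [claim: Mochizuki2012, status: disputed] -/
theorem trivial_biratFromF : (BadLocalFrobenioid.trivial l Kv).BiratFromF :=
  fun _ => ⟨CategoryTheory.Equivalence.refl, nonempty_iso_pt_pt _ _⟩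

/-- Ex. 3.2 (iii) `CFromF` ("`C_v ⊆ F̲_v` may be reconstructed category-theoretically from `F̲_v`")
holds on the trivial inhabitant. [claim: Mochizuki2012, status: disputed] -/
theorem trivial_cFromF : (BadLocalFrobenioid.trivial l Kv).CFromF :=
  reconstructibleAlong_of_pt _ nonempty_iso_pt_pt

/-- Ex. 3.2 (ii) `ThetaFromF` ("`T_{Ÿ_v}` and `Θ̲_v` [up to `μ_{2l}`, `l·ℤ`] may be reconstructed
category-theoretically from `F̲_v`") holds on the trivial inhabitant: every automorphism there is the
identity, which lies in the orbit of `Θ̲_v = id`. [claim: Mochizuki2012, status: disputed] -/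
theorem trivial_thetaFromF : (BadLocalFrobenioid.trivial l Kv).ThetaFromF := by
  intro e
  refine ⟨CategoryTheory.Equivalence.refl, isoOfPt _ _, Iso.refl _, fun x _ => ?_⟩
  have h : ∀ y : Aut ((BadLocalFrobenioid.trivial l Kv).birat.obj
      ((BadLocalFrobenioid.trivial l Kv).T (BadLocalFrobenioid.trivial l Kv).Ydd)),
      y = (BadLocalFrobenioid.trivial l Kv).theta :=
    fun y => @Subsingleton.elim _ (Witness.subsingleton_aut _) _ _
  rw [h (_ ≪≫ _ ≪≫ _)]
  exact theta_mem_thetaOrbit _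

/-- Ex. 3.2 (vi) (a) `DdashFromD` ("`D⊢_v ⊆ D_v` may be reconstructed category-theoretically from
`D_v`") holds on the trivial inhabitant. [claim: Mochizuki2012, status: disputed] -/
theorem trivial_ddashFromD : (BadLocalFrobenioid.trivial l Kv).DdashFromD :=
  reconstructibleAlong_of_pt _ nonempty_iso_pt_pt

/-- Ex. 3.2 (vi) (b) `DThetaFromD` ("`D^Θ_v` may be reconstructed category-theoretically from `D_v`")
holds on the trivial inhabitant. [claim: Mochizuki2012, status: disputed] -/
theorem trivial_dThetaFromD : (BadLocalFrobenioid.trivial l Kv).DThetaFromD :=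
  reconstructibleAlong_of_pt _ nonempty_iso_pt_pt

/-- Ex. 3.2 (vi) (c) `BasesFromC` ("`D⊢_v` (resp. `D^Θ_v`) may be reconstructed category-theoretically
from `C⊢_v` (resp. `C^Θ_v`)") holds on the trivial inhabitant. [claim: Mochizuki2012, status: disputed] -/
theorem trivial_basesFromC : (BadLocalFrobenioid.trivial l Kv).BasesFromC :=
  ⟨fun _ => ⟨CategoryTheory.Equivalence.refl, nonempty_iso_pt_pt _ _⟩,
    fun _ => ⟨CategoryTheory.Equivalence.refl, nonempty_iso_pt_pt _ _⟩⟩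

/-- Ex. 3.2 (vi) (d) `DFromF` ("`D_v` may be reconstructed category-theoretically either from `F̲_v`
or from `C_v`") holds on the trivial inhabitant. [claim: Mochizuki2012, status: disputed] -/
theorem trivial_dFromF : (BadLocalFrobenioid.trivial l Kv).DFromF :=
  ⟨fun _ => ⟨CategoryTheory.Equivalence.refl, nonempty_iso_pt_pt _ _⟩,
    fun _ => ⟨CategoryTheory.Equivalence.refl, nonempty_iso_pt_pt _ _⟩⟩

/-- Ex. 3.2 (vi) (e) `FthetaFromF` ("one may reconstruct the split Frobenioid `F^Θ_v` [up to the
`l·ℤ` indeterminacy] category-theoretically from `F̲_v`") holds on the trivial inhabitant (the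
splitting `⊥` is preserved, with orbit member `Θ̲_v` itself). [claim: Mochizuki2012, status: disputed] -/
theorem trivial_fthetaFromF : (BadLocalFrobenioid.trivial l Kv).FthetaFromF :=
  fun _ => ⟨CategoryTheory.Equivalence.refl, CategoryTheory.Equivalence.refl, nonempty_iso_pt_pt _ _,
    nonempty_iso_pt_pt _ _, (BadLocalFrobenioid.trivial l Kv).theta, theta_mem_thetaOrbit _,
    botSplitting_pt_isPreservedBy _⟩

/-- Ex. 3.2 (vi) (f) `FdashFromC` ("one may reconstruct the split Frobenioid `F⊢_v`
category-theoretically from `C_v`") holds on the trivial inhabitant (orbit member `τ⊢_v` itself).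
[claim: Mochizuki2012, status: disputed] -/
theorem trivial_fdashFromC : (BadLocalFrobenioid.trivial l Kv).FdashFromC :=
  fun _ => ⟨CategoryTheory.Equivalence.refl, nonempty_iso_pt_pt _ _,
    (BadLocalFrobenioid.trivial l Kv).tauDash, tauDash_mem_tauDashOrbit _, botSplitting_pt_isPreservedBy _⟩

/-- Rmk. 3.2.3 (i) `OrbitActsOnFtheta` ("`α` induces an isomorphism of the monoid `𝒪^▷_{C^Θ_v}(−)`
onto the monoid associated to `Θ̲^α_v`") holds on the trivial inhabitant (both monoid functors are the
constant functor at the trivial monoid). [claim: Mochizuki2012, status: disputed] -/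
theorem trivial_orbitActsOnFtheta : (BadLocalFrobenioid.trivial l Kv).OrbitActsOnFtheta :=
  fun _ _ => ⟨Iso.refl _⟩

/-- **Joint consistency of the Example 3.2 reconstruction clauses with the interface**: on abc-iut-L5-t2's
inhabitant `BadLocalFrobenioid.trivial l K_v` ALL TEN typed clauses of Ex. 3.2 (ii), (iii), (vi) (a)–(f)
and Rmk. 3.2.3 (i) hold simultaneously — so no statement hypothesising them on a `BadLocalFrobenioid` is
vacuous. (Kernel certificate for DAG nodes `IUTchI:Ex3.2(i)`–`(vi)`; the clauses themselves remain
properties to be proved of the real construction at merge.) [claim: Mochizuki2012, status: disputed] -/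
theorem trivial_ex32Claims :
    (BadLocalFrobenioid.trivial l Kv).BiratFromF ∧ (BadLocalFrobenioid.trivial l Kv).CFromF ∧
    (BadLocalFrobenioid.trivial l Kv).ThetaFromF ∧ (BadLocalFrobenioid.trivial l Kv).DdashFromD ∧
    (BadLocalFrobenioid.trivial l Kv).DThetaFromD ∧ (BadLocalFrobenioid.trivial l Kv).BasesFromC ∧
    (BadLocalFrobenioid.trivial l Kv).DFromF ∧ (BadLocalFrobenioid.trivial l Kv).FthetaFromF ∧
    (BadLocalFrobenioid.trivial l Kv).FdashFromC ∧ (BadLocalFrobenioid.trivial l Kv).OrbitActsOnFtheta :=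
  ⟨trivial_biratFromF l Kv, trivial_cFromF l Kv, trivial_thetaFromF l Kv, trivial_ddashFromD l Kv,
    trivial_dThetaFromD l Kv, trivial_basesFromC l Kv, trivial_dFromF l Kv, trivial_fthetaFromF l Kv,
    trivial_fdashFromC l Kv, trivial_orbitActsOnFtheta l Kv⟩

/-- Hence, for every `l` and every valued field `K_v`, the interface TOGETHER WITH all ten Example 3.2
reconstruction clauses is inhabited. [claim: Mochizuki2012, status: disputed] -/
theorem exists_ex32Claims :
    ∃ B : BadLocalFrobenioid.{0} l Kv, B.BiratFromF ∧ B.CFromF ∧ B.ThetaFromF ∧ B.DdashFromD ∧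
      B.DThetaFromD ∧ B.BasesFromC ∧ B.DFromF ∧ B.FthetaFromF ∧ B.FdashFromC ∧ B.OrbitActsOnFtheta :=
  ⟨BadLocalFrobenioid.trivial l Kv, trivial_ex32Claims l Kv⟩

end BadLocalFrobenioid

end Literature.IUT.HodgeTheaters
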